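import Literature.MathematicalPhysics.QuantumFieldTheory.Balaban1983to89.Beta.AffineAveraging

/-!
# `Balaban1983to89.Beta.AveragingContours` — Bałaban's axial block contours `Γ_{y,x}`, `Γ_{c,x}`,
# `Γ_{c,x} ∪ (−c)` as SIGNED LETTER LISTS of a lattice one-form, the linear averaging (1.8) = (14), its gauge
# covariance (1.9)/(1.13) and the axial gauge (1.10): combinatorial layer of the vector (V-H) stencil, v1.1.1

statement-level skeleton of published theorems with citation tags; proofs where landed; nothing here is a claim about the Yang–Mills mass gap

v1.3 (2026-08-21, lit-balaban cell, unit r02 gen 2 — DOCSTRING-ONLY): the cell's honest-framing sentence (the line above,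
verbatim and on one physical line, as the lit-balaban framing lint requires of every file filed by the cell) added to this
pre-cell β-leaf, which entered the cell's FILED list through the v1.2 locator patch; no declaration changed.

v1.2 (2026-08-20, lit-balaban cell, unit r02 — DOCSTRING-ONLY): the §5 theorem `linAvg_gauge` now carries the locator tag
`[cite: Balaban1984PropagatorsI, (1.9) p.19]` of the display it transcribes (lit-balaban ref-3 rule C.2: the declaration
a skeleton row rests on must carry the printed locator); it remains kernel-proved, nothing is cited AS A FACT; no
declaration changed.

v1.1 (same seat, same day): §5 NEW — gauge covariance (1.9)/(1.13), the axial gauge (1.10), its attainability (tree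
gauge) and rigidity, and «(1.8) = (1.11) on axial-gauge fields»; header now quotes the PRIMARY source
[Balaban1984PropagatorsI] pp.18–19 verbatim (B7 (14) is, in B7's words, «the linear averaging operation (1.8) of [2]»).
v1 = p186747 (commit 28039bf7a669): §§1–4, 6 unchanged.  v1.1 = p186999 (commit 0374af54f4b4).  v1.1.1 (same day):
DOCSTRING-ONLY — ABSOLUTE RULE header line (beta-ref A-R371), p.25 locators ((46) → the display after it; (48) quoted
as the disambiguator of «Γ_{x(c),c_+}», XREAD C-lit3g18-6 I1/I3); no declaration changed.

HONEST FRAMING (page 1, mandatory).  This leaf belongs to the β sub-cell of the Bałaban audit, whose END STATEMENT is: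
discharging the one-loop hypothesis `FlowStep.BetaPertH` (read at END-STATEMENT grade, RULING (R6)) makes Bałaban's
ultraviolet stability theorem for 4-d lattice Yang–Mills ([Balaban1989LargeFieldII], Thm. 1 p. 355 (B16))
UNCONDITIONAL inside this package — a real constructive-QFT result; it is NOT the continuum limit and NOT the Clay
problem.  Gloss 2: EVERYTHING below is kernel-proved [folklore] combinatorics of lists and finite sums on `ℤ^d`;
NOTHING is cited as a fact.  [Balaban1985Averaging] (= B7, CMP 98 (1985) 17–51; renders read as page images, PDF
page = journal page − 16) is quoted only to say WHICH objects are being typed.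

ABSOLUTE RULE (cell charter, verbatim; header line added v1.1.1 per beta-ref advisory A-R371, docstring-only): «No
internally-minted statement may enter as a cited fact. Every hypothesis is either kernel-proved in this package or a
verbatim quotation of a PUBLISHED theorem with page reference. The manuscript(s) under audit are NOT citable for their
own disputed steps — they are the thing under adjudication; programme-internal (2001/route/tribunal) claims are never
citable.»  Accordingly NO declaration below is a `def … : Prop` carrying a citation and no hypothesis of any theorem is
a printed statement: every declaration is [folklore]; the quotations are object LOCATORS only.

THE PRINTED OBJECTS (object locators, verbatim).  PRIMARY: [Balaban1984PropagatorsI] (= B5-I, CMP 95 (1984) 17–40;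
renders `pages/1984-cmp95-propagators-rt-I/…-p002/p003-x2.png` = pp.18–19, read as images).  p.18 (1.1)
«A_{⟨x,x+εe_μ⟩} = A(x, x + εe_μ) = A_μ(x)»; «We assume that A_b is defined for bonds b with arbitrary orientation and
that A_{⟨x,x′⟩} = −A_{⟨x′,x⟩}.»; (1.4) «A^λ_b = A_b − (∂λ)(b), (∂λ)(b) = ε^{−1}(λ(b_+) − λ(b_−)), b = ⟨b_−, b_+⟩»; (1.6)
«B(y) = {x ∈ T₁ : y_μ ≦ x_μ < y_μ + L, μ = 1, …, d}, y ∈ T^{(1)}_L»; (1.7) «Γ_{y,x} = [y,(y₁, …, y_{d−1}, x_d)] ∪ … ∪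
[(y₁, …, y_μ, x_{μ+1}, …, x_d), (y₁, …, x_μ, x_{μ+1}, …, x_d)] ∪ … ∪ [(y₁, x₂, …, x_d), x]», «We consider Γ_{y,x},
and all other contours appearing in the paper, as oriented contours, with initial point y and final point x.»; p.19
(1.8) «B_c = Σ_{x∈B(c_−)} L^{−(d+1)}(A(Γ_{c_−,x}) + A([x, x(c)]) + A(Γ_{x(c),c_+})), c = ⟨c_−, c_+⟩ ⊂ T^{(1)}_L», «where
A(Γ) = Σ_{b⊂Γ} A_b for arbitrary contour Γ, and x(c) denotes a point in the block B(c_+) obtained by translation of x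
by the bond c, so if c = ⟨y, y + Le_μ⟩ then x(c) = x + Le_μ.»; (1.9) «B^λ_c = B_c − L^{−1}(λ(c_+) − λ(c_−)) = B_c −
(∂λ)(c)»; «so fixing the average, we restrict the gauge transformations by the condition λ(y) = 0, y ∈ T^{(1)}_L, for
nonconstant λ. We still have the invariance with respect to the restricted transformations and we remove it by
introducing Axial (Ax) gauge fixing conditions A(Γ_{y,x}) = 0, x ∈ B(y), x ≠ y, y ∈ T^{(1)}_L.» (1.10); (1.11)
«(QA)_c = Σ_{x∈B(c_−)} L^{−(d+1)} A([x, x(c)])»; «We may define the averaging operation as given by Q directly. Then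
the average field B transforms as» (1.13) «B^λ_c = B_c − L^{−1}((Q′λ)(c_+) − (Q′λ)(c_−)) = B_c − (∂Q′λ)(c)»; «In the
future we will use both points of view.»  SECONDARY (the non-abelian paper whose (V-H) stencil this serves): B7 p.18: «Bonds of the lattice Ω are ordered pairs ⟨x, x′⟩ of
nearest neighbor points x, x′ of Ω. … b denotes a bond ⟨b_−, b_+⟩ with an initial point b_− and a final point b_+»;
(7) «U(x, x′) = U^{−1}(x′, x) = U*(x′, x)»; (9) «U(Γ) = Π_{i=0}^{n−1} U(x_i, x_{i+1}), where the order of factors in the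
product is the same as the order of bonds in Γ»; p.17 (2) «B^j(y) = {x ∈ L^{−j}L^nηZ^d : y_μ ≦ x_μ < y_μ + L^nη,
μ = 1, …, d}».  p.19 (14) «Ā_c = Σ_{x∈B(c_−)} L^{−(d+1)}(A(Γ_{c_−,x}) + A([x, x(c)]) + A(Γ_{x(c),c_+}))», then: «Let us
notice that Γ_{c_−,x} ∪ [x, x(c)] ∪ Γ_{x(c),c_+} is an oriented contour with c_− as an initial point and c_+ as a final
point. We denote it by Γ_{c,x}.», (15) «Ū_c = exp[i Σ_{x∈B(c_−)} L^{−d} (1/i) log U(Γ_{c,x})U(c)^{−1}] U(c)»; p.20: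
«taking U = e^{iA} with A small and expanding the logarithm of the expression on the right-hand side above in powers
of A, we get the expression (14) as a linear term in the expansion»; p.24: «Γ_{y,x} = [y, (y₁, …, y_{d−1}, x_d)] ∪ …
∪ [(y₁, x₂, …, x_d), x]»; p.25, the unnumbered display right after (46) [(46) itself numbers «Δ(p′) = B(y₀)∪B(y₁)∪
B(y₂)∪B(y)»; locator corrected v1.1.1, XREAD C-lit3g18-6 I3]: «|V₀(Γ_{c,x}) − 1| ≦ Σ_{b⊂Γ_{c,x}} |V_{0,b} − 1| <
|Γ_{c,x}|dLα₀ < (2d + 1)LdLα₀», whence |Γ_{c,x}| < (2d + 1)L; p.25 (48) «Σ_{c⊂∂p′} Σ_{x∈B(c_−)} L^{−d}A(Γ_{c,x}) =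
Σ_{x∈B(y₀)} L^{−d}A(∂(p′)_x) = Σ_{x∈B(y₀)} L^{−d} Σ_{p⊂(p′)_x} A(∂p). (48)» with «(p′)_x a plaquette obtained by translation
of the plaquette p′ to the point x» — the printed DISAMBIGUATOR of «Γ_{x(c),c_+}» (XREAD I1): (48) holds iff that piece
is the REVERSE of Γ_{c_+,x(c)}, as typed (`rev (axial …)`; the tails of Γ_{c,x} cancel pairwise around ∂p′ — the
mechanism of `linAvg_eq_straight_sub_grad` below; (48) itself is NOT typed here); p.34 (114) «Y_x = (1/i) log
V₀(Γ_{c,x} ∪ (−c))».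

WHAT IS TYPED (integer-coordinate transcription on the unit fine lattice `ℤ^d`, coarse lattice `Lℤ^d`, as in an2's
`Beta.AffineAveraging`, whose `Site`, `unitVec`, `Form1`, `box`, `toSite`, `dz`, `contourSum` are used BY NAME).  A
one-form `A : Form1 d R` assigns the letter `A κ x` to the positively oriented bond `⟨x, x + e_κ⟩`; by (7) at the
Lie-algebra level the reversed bond carries `−A κ x`, and by (9) a contour is the ORDERED LIST of the letters of its
bonds — so a contour is typed as a `List R` (`R` any `AddCommGroup`: colour components, or a noncommutative algebra),
which is exactly the input `l : List 𝔸` of `TransportVertices.holPath` (holonomy `Π e^{t·letter}`),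
`AdjointTransportJets.conjPath`, `AveragingCorrectionJets` §4 and `LogHolonomySecondJet.log_holPath_jets`.
* §1 straight segments `segUp`/`segDown`/`seg` (n bonds from `z` in direction `±κ`), reversal `rev` (negate and
  reverse), translation `shift`; lengths; telescoping on exact forms `grad f κ x = f (x + e_κ) − f x` (= an2's `dz`,
  `grad_eq_dz`, but over any `AddCommGroup`).
* §2 the axial contour `axial A y x` = letters of `Γ_{y,x}` (coordinates moved in the printed order: `x_d` first, `x₁`
  last; intermediate corners `corner y x m`); `axial_sum_grad : (axial (grad f) y x).sum = f x − f y`;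
  `axial_length = Σ_i |x_i − y_i|` and `≤ d·(L − 1)` on the block; translation covariance.
* §3 Bałaban's `Γ_{c,x}` for the coarse bond `c = ⟨L·y, L·y + L·e_μ⟩` and `x = L·y + b`, `b ∈ {0,…,L−1}^d`,
  `x(c) = x + L·e_μ`: `gammaC A L μ y b = axial ++ segUp (L bonds) ++ rev axial`; `gammaC_sum_grad = f(c_+) − f(c_−)`
  for EVERY `x` — the linearisation at `U = 1` of the gauge covariance (11) «(Ū^u)(y,y′) = u(y)Ū(y,y′)u^{−1}(y′)»
  with `u` «coinciding with v at points of the new lattice» (p.19); `gammaC_length_le : ≤ (2d+1)L − 2d` (cf. p.25,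
  the display after (46)); the closed loop `loopC = gammaC ++ rev (segUp c_− μ L)` of (15)/(114) with
  `loopC_sum_grad = 0`; translation covariance `gammaC_add`/`loopC_add`/`linAvg_add` (`y ↦ y + v` ≡
  `A ↦ shift (L·v) A`).
* §4 the unnormalised linear averaging (14) `linAvg A L μ y = Σ_{b} (gammaC A L μ y b).sum` (= `L^{d+1}·Ā_c`) and
  THE AXIAL TAILS ARE PURE GAUGE: `linAvg A L μ y = straightSum A L μ y + (Λ A L y − Λ A L (y + e_μ))` with
  `Λ A L y = Σ_b A(Γ_{L·y, L·y+b})` (`linAvg_eq_straight_sub_grad`); over a `CommRing`, `straightSum = contourSum`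
  (an2) — so (14) and an2's straight-contour average [Balaban1984PropagatorsI] (1.11) differ by the coarse exact form
  `grad Λ` (`linAvg_eq_contourSum_sub_dz`).
* §5 (v1.1) GAUGE: linearity in `A` (`…_sum_sub`); (1.9) `linAvg_gauge : linAvg (A − grad λ) = linAvg A − #B·(λ(c_+) −
  λ(c_−))`; (1.13) `straightSum_gauge` (block totals `blockTotal` = an2's `blockSum`, `contourSum_gauge`); (1.10)
  `AxialGauge A L`; `Lam_eq_zero_of_axialGauge`; **`linAvg_eq_straightSum_of_axialGauge` /
  `linAvg_eq_contourSum_of_axialGauge`: on axial-gauge fields (1.8) = (1.11) — Bałaban's «both points of view»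
  coincide**; `axialGauge_treeGauge`: the axial gauge is ATTAINED by `λ_A(x) = A(Γ_{y(x),x})` (block decomposition
  `blk`/`off`, `blk_add_off`); `axialGauge_rigid`: it is unique up to block-constant `λ`.
* §6 a kernel example on `ℤ²`, `L = 2` (`decide`): the six letters of `Γ_{c,x}` for `c = ⟨(0,0),(2,0)⟩`, `x = (1,1)`.
NOT HERE: holonomies/exponentials (feed the lists to `holPath`); the `L^{−(d+1)}`, `η` normalisations; plaquette
identities (48); Dirichlet/region data; positivity of `⟨∂A, ∂A⟩` on `QA = 0 ∧ Ax` ([B5] p.19, a CLAIM of the paper,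
not used); anything about minimisers or propagators; any claim of B5/B7.

Provenance: b2b-balaban β sub-cell, unit beta-an1 gen 10 (node 5 AVERAGING-CONTOURS), 2026-08-19.  Bib keys:
Balaban1985Averaging, Balaban1984PropagatorsI, Balaban1989LargeFieldII.
-/

namespace Literature.MathematicalPhysics.QuantumFieldTheory.Balaban1983to89.Beta.AveragingContours

open Finset
open Literature.MathematicalPhysics.QuantumFieldTheory.Balaban1983to89.Beta.AffineAveraging

/-! ## §1 Straight segments, reversal, translation, exact forms -/

section Segments

variable {d : ℕ} {R : Type*} [AddCommGroup R]

/-- [folklore] Exact one-form `(grad f)_κ(x) = f(x + e_κ) − f(x)` over any additive group (an2's `dz` over a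
`CommRing`, see `grad_eq_dz`). -/
def grad (f : Site d → R) : Form1 d R := fun κ x => f (x + unitVec κ) - f x

/-- [folklore] Translate of a one-form: `(shift v A)_κ(x) = A_κ(x + v)`. -/
def shift (v : Site d) (A : Form1 d R) : Form1 d R := fun κ x => A κ (x + v)

/-- [folklore] Letters of the straight contour of `n` bonds from `z` in direction `+κ`:
`[A_κ(z), A_κ(z + e_κ), …, A_κ(z + (n−1)e_κ)]`. -/
def segUp (A : Form1 d R) (z : Site d) (κ : Fin d) (n : ℕ) : List R :=
  (List.range n).map fun s => A κ (z + (s : ℤ) • unitVec κ)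

/-- [folklore] Letters of the straight contour of `n` bonds from `z` in direction `−κ`: the bonds
`⟨z − (s+1)e_κ, z − s e_κ⟩` traversed backwards carry `−A_κ(z − (s+1)e_κ)` ((7) at the Lie-algebra level). -/
def segDown (A : Form1 d R) (z : Site d) (κ : Fin d) (n : ℕ) : List R :=
  (List.range n).map fun s => -A κ (z - ((s : ℤ) + 1) • unitVec κ)

/-- [folklore] Letters of the straight contour from `z` to `z + n·e_κ`, `n : ℤ`. -/
def seg (A : Form1 d R) (z : Site d) (κ : Fin d) (n : ℤ) : List R :=
  if 0 ≤ n then segUp A z κ n.toNat else segDown A z κ (-n).toNat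

/-- [folklore] The reversed contour: letters negated, order reversed. -/
def rev (l : List R) : List R := (l.map fun a => -a).reverse

omit [AddCommGroup R] in
/-- [folklore] `|segUp| = n`. -/
@[simp] theorem segUp_length (A : Form1 d R) (z : Site d) (κ : Fin d) (n : ℕ) :
    (segUp A z κ n).length = n := by simp [segUp]

/-- [folklore] `|segDown| = n`. -/
@[simp] theorem segDown_length (A : Form1 d R) (z : Site d) (κ : Fin d) (n : ℕ) :
    (segDown A z κ n).length = n := by simp [segDown]

/-- [folklore] `|seg| = |n|`. -/
theorem seg_length (A : Form1 d R) (z : Site d) (κ : Fin d) (n : ℤ) : (seg A z κ n).length = n.natAbs := by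
  unfold seg
  split_ifs with h
  · simp; omega
  · simp; omega

/-- [folklore] Reversal preserves length. -/
@[simp] theorem rev_length (l : List R) : (rev l).length = l.length := by simp [rev]

/-- [folklore] `Σ rev l = −Σ l`. -/
@[simp] theorem rev_sum (l : List R) : (rev l).sum = -l.sum := by
  unfold rev
  rw [List.sum_reverse]
  induction l with
  | nil => simp
  | cons a l ih => simp [ih]; abel

omit [AddCommGroup R] in
/-- [folklore] The empty segment. -/
@[simp] theorem segUp_zero (A : Form1 d R) (z : Site d) (κ : Fin d) : segUp A z κ 0 = [] := by simp [segUp]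

omit [AddCommGroup R] in
/-- [folklore] One more bond, `+κ`. -/
theorem segUp_succ (A : Form1 d R) (z : Site d) (κ : Fin d) (n : ℕ) :
    segUp A z κ (n + 1) = segUp A z κ n ++ [A κ (z + (n : ℤ) • unitVec κ)] := by
  simp [segUp, List.range_succ]

/-- [folklore] The empty segment, `−κ`. -/
@[simp] theorem segDown_zero (A : Form1 d R) (z : Site d) (κ : Fin d) : segDown A z κ 0 = [] := by
  simp [segDown]

/-- [folklore] One more bond, `−κ`. -/
theorem segDown_succ (A : Form1 d R) (z : Site d) (κ : Fin d) (n : ℕ) :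
    segDown A z κ (n + 1) = segDown A z κ n ++ [-A κ (z - ((n : ℤ) + 1) • unitVec κ)] := by
  simp [segDown, List.range_succ]

/-- [folklore] Telescoping, `+κ`: `Σ segUp (grad f) z κ n = f(z + n e_κ) − f(z)`. -/
theorem segUp_sum_grad (f : Site d → R) (z : Site d) (κ : Fin d) (n : ℕ) :
    (segUp (grad f) z κ n).sum = f (z + (n : ℤ) • unitVec κ) - f z := by
  induction n with
  | zero => simp
  | succ n ih =>
    rw [segUp_succ, List.sum_append, ih, List.sum_singleton]
    simp only [grad, Nat.cast_succ, add_smul, one_smul, add_assoc]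
    abel

/-- [folklore] Telescoping, `−κ`: `Σ segDown (grad f) z κ n = f(z − n e_κ) − f(z)`. -/
theorem segDown_sum_grad (f : Site d → R) (z : Site d) (κ : Fin d) (n : ℕ) :
    (segDown (grad f) z κ n).sum = f (z - (n : ℤ) • unitVec κ) - f z := by
  induction n with
  | zero => simp
  | succ n ih =>
    rw [segDown_succ, List.sum_append, ih, List.sum_singleton]
    have h : z - ((n : ℤ) + 1) • unitVec κ + unitVec κ = z - (n : ℤ) • unitVec κ := by
      rw [add_smul, one_smul]; abel
    simp only [grad, h, Nat.cast_succ]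
    abel

/-- [folklore] Telescoping, signed: `Σ seg (grad f) z κ n = f(z + n e_κ) − f(z)`. -/
theorem seg_sum_grad (f : Site d → R) (z : Site d) (κ : Fin d) (n : ℤ) :
    (seg (grad f) z κ n).sum = f (z + n • unitVec κ) - f z := by
  unfold seg
  split_ifs with h
  · rw [segUp_sum_grad, Int.toNat_of_nonneg h]
  · rw [segDown_sum_grad]
    have hn : ((-n).toNat : ℤ) = -n := Int.toNat_of_nonneg (by omega)
    rw [hn, neg_smul, sub_neg_eq_add]

omit [AddCommGroup R] in
/-- [folklore] Translation covariance of segments. -/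
theorem segUp_add (A : Form1 d R) (z v : Site d) (κ : Fin d) (n : ℕ) :
    segUp A (z + v) κ n = segUp (shift v A) z κ n := by
  simp only [segUp, shift]
  refine List.map_congr_left fun s _ => ?_
  congr 1; abel

/-- [folklore] Translation covariance of segments, `−κ`. -/
theorem segDown_add (A : Form1 d R) (z v : Site d) (κ : Fin d) (n : ℕ) :
    segDown A (z + v) κ n = segDown (shift v A) z κ n := by
  simp only [segDown, shift]
  refine List.map_congr_left fun s _ => ?_
  congr 2; abel

/-- [folklore] Translation covariance of signed segments. -/
theorem seg_add (A : Form1 d R) (z v : Site d) (κ : Fin d) (n : ℤ) :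
    seg A (z + v) κ n = seg (shift v A) z κ n := by
  unfold seg; split_ifs <;> simp [segUp_add, segDown_add]

/-- [folklore] `grad` commutes with translation. -/
theorem shift_grad (v : Site d) (f : Site d → R) : shift v (grad f) = grad (fun x => f (x + v)) := by
  funext κ x
  simp only [shift, grad]
  congr 1
  · congr 1; abel

end Segments

/-! ## §2 The axial contour `Γ_{y,x}` -/

section Axial

variable {d : ℕ} {R : Type*} [AddCommGroup R]

/-- [folklore] Intermediate corner of `Γ_{y,x}`: coordinates `j ≥ m` already at `x_j`, coordinates `j < m` still at
`y_j` (so `corner y x d = y`, `corner y x 0 = x`; the printed order moves `x_d` first). -/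
def corner (y x : Site d) (m : ℕ) : Site d := fun j => if m ≤ (j : ℕ) then x j else y j

/-- [folklore] `corner y x 0 = x`. -/
@[simp] theorem corner_zero (y x : Site d) : corner y x 0 = x := by
  funext j; simp [corner]

/-- [folklore] `corner y x m = y` for `m ≥ d`. -/
theorem corner_of_le (y x : Site d) {m : ℕ} (hm : d ≤ m) : corner y x m = y := by
  funext j; simp [corner]; omega

/-- [folklore] `corner y x d = y`. -/
@[simp] theorem corner_d (y x : Site d) : corner y x d = y := corner_of_le y x le_rfl

/-- [folklore] The chain identity: moving coordinate `m` from `y_m` to `x_m` takes `corner (m+1)` to `corner m`. -/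
theorem corner_succ_add (y x : Site d) (m : ℕ) (h : m < d) :
    corner y x (m + 1) + (x ⟨m, h⟩ - y ⟨m, h⟩) • unitVec ⟨m, h⟩ = corner y x m := by
  funext j
  simp only [corner, Pi.add_apply, Pi.smul_apply, unitVec_apply, smul_eq_mul]
  by_cases hj : j = ⟨m, h⟩
  · subst hj; simp
  · have hj' : (j : ℕ) ≠ m := fun e => hj (Fin.ext e)
    simp only [hj, if_false, mul_zero, add_zero]
    by_cases h1 : m + 1 ≤ (j : ℕ)
    · simp [h1, show m ≤ (j : ℕ) by omega]
    · simp [h1, show ¬ m ≤ (j : ℕ) by omega]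

/-- [folklore] Corners are translation covariant. -/
theorem corner_add (y x v : Site d) (m : ℕ) : corner (y + v) (x + v) m = corner y x m + v := by
  funext j; by_cases h : m ≤ (j : ℕ) <;> simp [corner, h]

/-- [folklore] Letters of the part of `Γ_{y,x}` from `corner y x m` to `x` (directions `m−1, …, 0`). -/
def axialAux (A : Form1 d R) (y x : Site d) : ℕ → List R
  | 0 => []
  | m + 1 =>
    (if h : m < d then seg A (corner y x (m + 1)) ⟨m, h⟩ (x ⟨m, h⟩ - y ⟨m, h⟩) else []) ++ axialAux A y x m

/-- [folklore] THE AXIAL CONTOUR `Γ_{y,x}` (B7 p.24) as a letter list: first the segment moving `x_d`, last the one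
moving `x₁`. -/
def axial (A : Form1 d R) (y x : Site d) : List R := axialAux A y x d

/-- [folklore] Telescoping along `Γ`: from `corner m` to `x`. -/
theorem axialAux_sum_grad (f : Site d → R) (y x : Site d) :
    ∀ m, m ≤ d → (axialAux (grad f) y x m).sum = f x - f (corner y x m)
  | 0, _ => by simp [axialAux]
  | m + 1, hm => by
    have h : m < d := by omega
    simp only [axialAux, h, dif_pos, List.sum_append]
    rw [axialAux_sum_grad f y x m (by omega), seg_sum_grad, corner_succ_add]
    abel

/-- [folklore] `A(Γ_{y,x}) = f(x) − f(y)` for the exact form `A = grad f`. -/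
theorem axial_sum_grad (f : Site d → R) (y x : Site d) : (axial (grad f) y x).sum = f x - f y := by
  rw [axial, axialAux_sum_grad f y x d le_rfl, corner_d]

/-- [folklore] Length of the partial axial contour. -/
theorem axialAux_length (A : Form1 d R) (y x : Site d) :
    ∀ m, m ≤ d → (axialAux A y x m).length
      = ∑ i ∈ Finset.range m, (if h : i < d then (x ⟨i, h⟩ - y ⟨i, h⟩).natAbs else 0)
  | 0, _ => by simp [axialAux]
  | m + 1, hm => by
    have h : m < d := by omega
    simp only [axialAux, h, dif_pos, List.length_append, seg_length, Finset.sum_range_succ]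
    rw [axialAux_length A y x m (by omega)]
    simp [add_comm]

/-- [folklore] `|Γ_{y,x}| = Σ_i |x_i − y_i|` (the ℓ¹ distance). -/
theorem axial_length (A : Form1 d R) (y x : Site d) :
    (axial A y x).length = ∑ i : Fin d, (x i - y i).natAbs := by
  rw [axial, axialAux_length A y x d le_rfl,
    ← Fin.sum_univ_eq_sum_range (fun i => if h : i < d then (x ⟨i, h⟩ - y ⟨i, h⟩).natAbs else 0) d]
  refine Finset.sum_congr rfl fun i _ => ?_
  simp [i.2]

/-- [folklore] On the block `B(y) = {x : 0 ≤ x_i − y_i < L}`: `|Γ_{y,x}| ≤ d·(L − 1)`. -/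
theorem axial_length_le (A : Form1 d R) (y x : Site d) (L : ℕ)
    (hx : ∀ i, 0 ≤ x i - y i ∧ x i - y i < L) : (axial A y x).length ≤ d * (L - 1) := by
  rw [axial_length]
  calc ∑ i : Fin d, (x i - y i).natAbs ≤ ∑ _i : Fin d, (L - 1) := by
        refine Finset.sum_le_sum fun i _ => ?_
        have h1 := (hx i).1; have h2 := (hx i).2
        omega
    _ = d * (L - 1) := by simp

/-- [folklore] On the block in offset form: `|Γ_{z, z+b}| ≤ d·(L − 1)` for `b ∈ {0,…,L−1}^d`. -/
theorem axial_length_block (A : Form1 d R) (z : Site d) {L : ℕ} {b : Fin d → ℕ} (hb : ∀ i, b i < L) :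
    (axial A z (z + toSite b)).length ≤ d * (L - 1) :=
  axial_length_le A z (z + toSite b) L fun i => by
    simp only [Pi.add_apply, toSite, add_sub_cancel_left]
    exact ⟨by positivity, by exact_mod_cast hb i⟩

/-- [folklore] Translation covariance of `Γ_{y,x}`. -/
theorem axialAux_add (A : Form1 d R) (y x v : Site d) :
    ∀ m, axialAux A (y + v) (x + v) m = axialAux (shift v A) y x m
  | 0 => rfl
  | m + 1 => by
    simp only [axialAux, axialAux_add A y x v m, corner_add, Pi.add_apply, add_sub_add_right_eq_sub, seg_add]

/-- [folklore] Translation covariance of `Γ_{y,x}`: `Γ_{y+v,x+v}` reads the translated form. -/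
theorem axial_add (A : Form1 d R) (y x v : Site d) : axial A (y + v) (x + v) = axial (shift v A) y x :=
  axialAux_add A y x v d

end Axial

/-! ## §3 Bałaban's block contour `Γ_{c,x}` and the closed loop `Γ_{c,x} ∪ (−c)` -/

section Gamma

variable {d : ℕ} {R : Type*} [AddCommGroup R]

/-- [folklore] `Γ_{c,x}` (B7 p.19) for the coarse bond `c = ⟨c_−, c_+⟩ = ⟨L·y, L·y + L·e_μ⟩` (`y ∈ ℤ^d` the coarse
index) and the fine point `x = L·y + b`: `Γ_{c_−,x} ∪ [x, x(c)] ∪ Γ_{x(c),c_+}` with `x(c) = x + L·e_μ`, the last piece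
being `Γ_{c_+,x(c)}` reversed. -/
def gammaC (A : Form1 d R) (L : ℕ) (μ : Fin d) (y : Site d) (b : Fin d → ℕ) : List R :=
  axial A ((L : ℤ) • y) ((L : ℤ) • y + toSite b)
    ++ segUp A ((L : ℤ) • y + toSite b) μ L
    ++ rev (axial A ((L : ℤ) • y + (L : ℤ) • unitVec μ) ((L : ℤ) • y + toSite b + (L : ℤ) • unitVec μ))

/-- [folklore] The closed loop `Γ_{c,x} ∪ (−c)` of (15)/(114): back from `c_+` to `c_−` along the reversed straight
coarse bond (its `L` fine bonds). -/
def loopC (A : Form1 d R) (L : ℕ) (μ : Fin d) (y : Site d) (b : Fin d → ℕ) : List R :=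
  gammaC A L μ y b ++ rev (segUp A ((L : ℤ) • y) μ L)

/-- [folklore] LINEARISED GAUGE COVARIANCE: for an exact fine form `A = grad f`, `A(Γ_{c,x}) = f(c_+) − f(c_−)` for
EVERY `x ∈ B(c_−)` (exact fine data average to the exact coarse form of the restricted gauge function). -/
theorem gammaC_sum_grad (f : Site d → R) (L : ℕ) (μ : Fin d) (y : Site d) (b : Fin d → ℕ) :
    (gammaC (grad f) L μ y b).sum = f ((L : ℤ) • y + (L : ℤ) • unitVec μ) - f ((L : ℤ) • y) := by
  simp only [gammaC, List.sum_append, rev_sum, axial_sum_grad, segUp_sum_grad]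
  abel

/-- [folklore] The closed loop has zero circulation on exact forms. -/
theorem loopC_sum_grad (f : Site d → R) (L : ℕ) (μ : Fin d) (y : Site d) (b : Fin d → ℕ) :
    (loopC (grad f) L μ y b).sum = 0 := by
  simp only [loopC, List.sum_append, rev_sum, gammaC_sum_grad, segUp_sum_grad]
  abel

/-- [folklore] `|Γ_{c,x}| ≤ (2d+1)L − 2d` for `x ∈ B(c_−)` (cf. B7 p.25, the display after (46): «… < |Γ_{c,x}|dLα₀ <
(2d+1)LdLα₀», i.e. |Γ_{c,x}| < (2d+1)L). -/
theorem gammaC_length_le (A : Form1 d R) {L : ℕ} (hL : 1 ≤ L) (μ : Fin d) (y : Site d) {b : Fin d → ℕ}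
    (hb : b ∈ box d L) : (gammaC A L μ y b).length ≤ (2 * d + 1) * L - 2 * d := by
  have hb' : ∀ i, b i < L := by
    simpa [AffineAveraging.box, Fintype.mem_piFinset, Finset.mem_range] using hb
  have h1 : (axial A ((L : ℤ) • y) ((L : ℤ) • y + toSite b)).length ≤ d * (L - 1) :=
    axial_length_block A _ hb'
  have hx : (L : ℤ) • y + toSite b + (L : ℤ) • unitVec μ = ((L : ℤ) • y + (L : ℤ) • unitVec μ) + toSite b := by
    abel
  have h2 : (axial A ((L : ℤ) • y + (L : ℤ) • unitVec μ) ((L : ℤ) • y + toSite b + (L : ℤ) • unitVec μ)).length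
      ≤ d * (L - 1) := by
    rw [hx]; exact axial_length_block A _ hb'
  simp only [gammaC, List.length_append, segUp_length, rev_length]
  have hd : 2 * d ≤ (2 * d + 1) * L := by nlinarith
  zify [hd, hL] at h1 h2 ⊢
  nlinarith

/-- [folklore] `|Γ_{c,x} ∪ (−c)| ≤ (2d+2)L − 2d`. -/
theorem loopC_length_le (A : Form1 d R) {L : ℕ} (hL : 1 ≤ L) (μ : Fin d) (y : Site d) {b : Fin d → ℕ}
    (hb : b ∈ box d L) : (loopC A L μ y b).length ≤ (2 * d + 2) * L - 2 * d := by
  have h := gammaC_length_le A hL μ y hb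
  simp only [loopC, List.length_append, rev_length, segUp_length]
  have hd : 2 * d ≤ (2 * d + 1) * L := by nlinarith
  zify [hd, hL, show 2 * d ≤ (2 * d + 2) * L by nlinarith] at h ⊢
  nlinarith

/-- [folklore] TRANSLATION COVARIANCE of `Γ_{c,x}`: shifting the coarse index `y ↦ y + v` is the same as reading the
translated form `shift (L·v) A` (the input of the translation law of an2's `LocStencil`). -/
theorem gammaC_add (A : Form1 d R) (L : ℕ) (μ : Fin d) (y v : Site d) (b : Fin d → ℕ) :
    gammaC A L μ (y + v) b = gammaC (shift ((L : ℤ) • v) A) L μ y b := by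
  have e1 : (L : ℤ) • (y + v) = (L : ℤ) • y + (L : ℤ) • v := smul_add _ _ _
  have e2 : (L : ℤ) • y + (L : ℤ) • v + toSite b = ((L : ℤ) • y + toSite b) + (L : ℤ) • v := by abel
  have e3 : (L : ℤ) • y + (L : ℤ) • v + (L : ℤ) • unitVec μ = ((L : ℤ) • y + (L : ℤ) • unitVec μ) + (L : ℤ) • v := by
    abel
  have e4 : (L : ℤ) • y + toSite b + (L : ℤ) • v + (L : ℤ) • unitVec μ
      = ((L : ℤ) • y + toSite b + (L : ℤ) • unitVec μ) + (L : ℤ) • v := by abel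
  simp only [gammaC, e1, e2, e3, e4, axial_add, segUp_add]

/-- [folklore] Translation covariance of the closed loop. -/
theorem loopC_add (A : Form1 d R) (L : ℕ) (μ : Fin d) (y v : Site d) (b : Fin d → ℕ) :
    loopC A L μ (y + v) b = loopC (shift ((L : ℤ) • v) A) L μ y b := by
  simp only [loopC, gammaC_add, smul_add, segUp_add]

end Gamma

/-! ## §4 The linear averaging (14) and «the axial tails are pure gauge» -/

section LinAvg

variable {d : ℕ} {R : Type*} [AddCommGroup R]

/-- [folklore] The unnormalised linear averaging (14): `Σ_{x∈B(c_−)} A(Γ_{c,x})` (= `L^{d+1}·Ā_c`). -/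
def linAvg (A : Form1 d R) (L : ℕ) (μ : Fin d) (y : Site d) : R :=
  ∑ b ∈ box d L, (gammaC A L μ y b).sum

/-- [folklore] The unnormalised straight-contour sum `Σ_{x∈B(c_−)} A([x, x(c)])` (an2's `contourSum` over a
`CommRing`, `straightSum_eq_contourSum`). -/
def straightSum (A : Form1 d R) (L : ℕ) (μ : Fin d) (y : Site d) : R :=
  ∑ b ∈ box d L, (segUp A ((L : ℤ) • y + toSite b) μ L).sum

/-- [folklore] The block axial potential `Λ(y) = Σ_{x∈B(y)} A(Γ_{L·y, x})`. -/
def Lam (A : Form1 d R) (L : ℕ) (y : Site d) : R :=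
  ∑ b ∈ box d L, (axial A ((L : ℤ) • y) ((L : ℤ) • y + toSite b)).sum

/-- [folklore] THE AXIAL TAILS ARE PURE GAUGE: (14) = straight-contour sum + (Λ(c_−) − Λ(c_+)), i.e.
`linAvg = straightSum − grad Λ` on the coarse lattice. -/
theorem linAvg_eq_straight_sub_grad (A : Form1 d R) (L : ℕ) (μ : Fin d) (y : Site d) :
    linAvg A L μ y = straightSum A L μ y + (Lam A L y - Lam A L (y + unitVec μ)) := by
  have hc : (L : ℤ) • y + (L : ℤ) • unitVec μ = (L : ℤ) • (y + unitVec μ) := by rw [smul_add]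
  have hx : ∀ b : Fin d → ℕ, (L : ℤ) • y + toSite b + (L : ℤ) • unitVec μ = (L : ℤ) • (y + unitVec μ) + toSite b := by
    intro b; rw [smul_add]; abel
  simp only [linAvg, straightSum, Lam, gammaC, List.sum_append, rev_sum, hc, hx, Finset.sum_add_distrib,
    Finset.sum_neg_distrib]
  abel

/-- [folklore] … as an identity of coarse one-forms: `linAvg A L = straightSum A L − grad (Lam A L)`. -/
theorem linAvg_eq (A : Form1 d R) (L : ℕ) :
    (fun μ y => linAvg A L μ y) = (fun μ y => straightSum A L μ y) - grad (Lam A L) := by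
  funext μ y
  simp only [Pi.sub_apply, grad, linAvg_eq_straight_sub_grad]
  abel

/-- [folklore] On exact forms the linear averaging is the coarse exact form of the restricted gauge function, times
the block cardinality: `linAvg (grad f) L μ y = #B · (f(c_+) − f(c_−))`. -/
theorem linAvg_grad (f : Site d → R) (L : ℕ) (μ : Fin d) (y : Site d) :
    linAvg (grad f) L μ y = (box d L).card • (f ((L : ℤ) • y + (L : ℤ) • unitVec μ) - f ((L : ℤ) • y)) := by
  simp only [linAvg, gammaC_sum_grad, Finset.sum_const]

/-- [folklore] Translation covariance of (14). -/
theorem linAvg_add (A : Form1 d R) (L : ℕ) (μ : Fin d) (y v : Site d) :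
    linAvg A L μ (y + v) = linAvg (shift ((L : ℤ) • v) A) L μ y := by
  simp only [linAvg, gammaC_add]

end LinAvg

section Bridge

variable {d : ℕ} {R : Type*} [CommRing R]

/-- [folklore] Over a commutative ring, `grad = AffineAveraging.dz`. -/
theorem grad_eq_dz (f : Form0 d R) : grad f = dz f := rfl

/-- [folklore] The letters of a straight segment sum to an2's `Finset.range` sum. -/
theorem segUp_sum (A : Form1 d R) (z : Site d) (κ : Fin d) (n : ℕ) :
    (segUp A z κ n).sum = ∑ s ∈ Finset.range n, A κ (z + (s : ℤ) • unitVec κ) := by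
  induction n with
  | zero => simp
  | succ n ih => rw [segUp_succ, List.sum_append, ih, Finset.sum_range_succ, List.sum_singleton]

/-- [folklore] BRIDGE to an2: `straightSum A L μ y = AffineAveraging.contourSum L A μ y`. -/
theorem straightSum_eq_contourSum (A : Form1 d R) (L : ℕ) (μ : Fin d) (y : Site d) :
    straightSum A L μ y = contourSum L A μ y := by
  simp only [straightSum, contourSum, segUp_sum]

/-- [folklore] Hence (14) = an2's straight-contour sum [Balaban1984PropagatorsI] (1.11) MINUS the coarse exact form
`dz Λ`: the two linear averagings differ by a (linearised) gauge transformation of the coarse field. -/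
theorem linAvg_eq_contourSum_sub_dz (A : Form1 d R) (L : ℕ) (μ : Fin d) (y : Site d) :
    linAvg A L μ y = contourSum L A μ y - dz (Lam A L) μ y := by
  rw [linAvg_eq_straight_sub_grad, straightSum_eq_contourSum, dz]
  abel

end Bridge

/-! ## §5 Gauge covariance and the axial gauge: [Balaban1984PropagatorsI] (1.9), (1.10), (1.11), (1.13)

Kernel transcriptions (unnormalised: `× L^{d+1}`) of the printed sentences on [B5] p.19: (1.9) «B^λ_c = B_c −
L^{−1}(λ(c_+) − λ(c_−)) = B_c − (∂λ)(c)»; (1.10) «Axial (Ax) gauge fixing conditions A(Γ_{y,x}) = 0, x ∈ B(y), x ≠ y»;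
(1.11) «(QA)_c = Σ_{x∈B(c_−)} L^{−(d+1)} A([x, x(c)])»; (1.13) «B^λ_c = B_c − L^{−1}((Q′λ)(c_+) − (Q′λ)(c_−))» for the
averaging «given by Q directly»; «In the future we will use both points of view.» — ON AXIAL-GAUGE FIELDS THE TWO POINTS
OF VIEW COINCIDE (`linAvg_eq_straightSum_of_axialGauge`). -/

section Gauge

variable {d : ℕ} {R : Type*} [AddCommGroup R]

/-- [folklore] `Γ_{y,y}` is the empty contour (partial version). -/
theorem axialAux_self (A : Form1 d R) (y : Site d) : ∀ m, axialAux A y y m = []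
  | 0 => rfl
  | m + 1 => by
    simp only [axialAux, axialAux_self A y m, sub_self, List.append_nil]
    split <;> simp [seg]

/-- [folklore] `Γ_{y,y}` is the empty contour. -/
@[simp] theorem axial_self (A : Form1 d R) (y : Site d) : axial A y y = [] := axialAux_self A y d

/-- [folklore] Letters are linear in the form: straight segments, differences. -/
theorem segUp_sum_sub (A A' : Form1 d R) (z : Site d) (κ : Fin d) (n : ℕ) :
    (segUp (A - A') z κ n).sum = (segUp A z κ n).sum - (segUp A' z κ n).sum := by
  induction n with
  | zero => simp
  | succ n ih => simp only [segUp_succ, List.sum_append, List.sum_singleton, ih, Pi.sub_apply]; abel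

/-- [folklore] … `−κ` segments. -/
theorem segDown_sum_sub (A A' : Form1 d R) (z : Site d) (κ : Fin d) (n : ℕ) :
    (segDown (A - A') z κ n).sum = (segDown A z κ n).sum - (segDown A' z κ n).sum := by
  induction n with
  | zero => simp
  | succ n ih => simp only [segDown_succ, List.sum_append, List.sum_singleton, ih, Pi.sub_apply]; abel

/-- [folklore] … signed segments. -/
theorem seg_sum_sub (A A' : Form1 d R) (z : Site d) (κ : Fin d) (n : ℤ) :
    (seg (A - A') z κ n).sum = (seg A z κ n).sum - (seg A' z κ n).sum := by
  unfold seg; split_ifs <;> simp [segUp_sum_sub, segDown_sum_sub]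

/-- [folklore] … partial axial contours. -/
theorem axialAux_sum_sub (A A' : Form1 d R) (y x : Site d) :
    ∀ m, (axialAux (A - A') y x m).sum = (axialAux A y x m).sum - (axialAux A' y x m).sum
  | 0 => by simp [axialAux]
  | m + 1 => by
    simp only [axialAux, List.sum_append, axialAux_sum_sub A A' y x m]
    split
    · simp [seg_sum_sub]; abel
    · simp

/-- [folklore] `A(Γ_{y,x})` is linear in `A` (differences). -/
theorem axial_sum_sub (A A' : Form1 d R) (y x : Site d) :
    (axial (A - A') y x).sum = (axial A y x).sum - (axial A' y x).sum :=
  axialAux_sum_sub A A' y x d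

/-- [folklore] `A(Γ_{c,x})` is linear in `A` (differences). -/
theorem gammaC_sum_sub (A A' : Form1 d R) (L : ℕ) (μ : Fin d) (y : Site d) (b : Fin d → ℕ) :
    (gammaC (A - A') L μ y b).sum = (gammaC A L μ y b).sum - (gammaC A' L μ y b).sum := by
  simp only [gammaC, List.sum_append, rev_sum, axial_sum_sub, segUp_sum_sub]
  abel

/-- **(1.9), GAUGE COVARIANCE OF THE LINEAR AVERAGING (unnormalised):** under `A ↦ A − grad λ` the averaged
field changes by the COARSE gradient of the restriction of `λ` to the coarse lattice, times `#B = L^d` (printed: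
`B^λ_c = B_c − L^{−1}(λ(c_+) − λ(c_−))`, the `L^{−1}` being `L^d · L^{−(d+1)}`).  Kernel-proved combinatorics; the tag is
the LOCATOR of the printed display this theorem transcribes (v1.2), not a cited input. [cite: Balaban1984PropagatorsI, (1.9) p.19] -/
theorem linAvg_gauge (A : Form1 d R) (lam : Site d → R) (L : ℕ) (μ : Fin d) (y : Site d) :
    linAvg (A - grad lam) L μ y
      = linAvg A L μ y - (box d L).card • (lam ((L : ℤ) • y + (L : ℤ) • unitVec μ) - lam ((L : ℤ) • y)) := by
  simp only [linAvg, gammaC_sum_sub, Finset.sum_sub_distrib, gammaC_sum_grad, Finset.sum_const, smul_sub]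

/-- [folklore] The unnormalised block total `Σ_{x∈B(y)} λ(x)` (= `L^d · (Q′λ)(y)` of (1.13); an2's `blockSum` over a
`CommRing`, `blockTotal_eq_blockSum`). -/
def blockTotal (lam : Site d → R) (L : ℕ) (y : Site d) : R := ∑ b ∈ box d L, lam ((L : ℤ) • y + toSite b)

/-- [folklore] **(1.13), GAUGE COVARIANCE OF THE STRAIGHT AVERAGING `Q` (unnormalised):** under `A ↦ A − grad λ`,
`Σ_x A([x, x(c)])` changes by the coarse gradient of the block total of `λ` (printed: `B^λ_c = B_c − L^{−1}((Q′λ)(c_+) −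
(Q′λ)(c_−))`). -/
theorem straightSum_gauge (A : Form1 d R) (lam : Site d → R) (L : ℕ) (μ : Fin d) (y : Site d) :
    straightSum (A - grad lam) L μ y
      = straightSum A L μ y - (blockTotal lam L (y + unitVec μ) - blockTotal lam L y) := by
  have hx : ∀ b : Fin d → ℕ, (L : ℤ) • y + toSite b + ((L : ℕ) : ℤ) • unitVec μ = (L : ℤ) • (y + unitVec μ) + toSite b := by
    intro b; rw [smul_add]; abel
  simp only [straightSum, blockTotal, segUp_sum_sub, Finset.sum_sub_distrib, segUp_sum_grad, hx]

/-- [folklore] **(1.10), THE AXIAL GAUGE inside the blocks:** `A(Γ_{y,x}) = 0` for every block `B(y)` (`y = L·y′`) and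
every `x ∈ B(y)` (for `x = y` the contour is empty, `axial_self`). -/
def AxialGauge (A : Form1 d R) (L : ℕ) : Prop :=
  ∀ (y : Site d) (b : Fin d → ℕ), b ∈ box d L → (axial A ((L : ℤ) • y) ((L : ℤ) • y + toSite b)).sum = 0

/-- [folklore] In the axial gauge the block axial potential vanishes. -/
theorem Lam_eq_zero_of_axialGauge {A : Form1 d R} {L : ℕ} (hA : AxialGauge A L) (y : Site d) : Lam A L y = 0 :=
  Finset.sum_eq_zero fun b hb => hA y b hb

/-- [folklore] **ON AXIAL-GAUGE FIELDS BAŁABAN'S TWO POINTS OF VIEW COINCIDE:** (1.8) = (1.11), i.e.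
`Σ_x A(Γ_{c,x}) = Σ_x A([x, x(c)])` whenever `A(Γ_{y,x}) = 0` inside the blocks. -/
theorem linAvg_eq_straightSum_of_axialGauge {A : Form1 d R} {L : ℕ} (hA : AxialGauge A L) (μ : Fin d) (y : Site d) :
    linAvg A L μ y = straightSum A L μ y := by
  rw [linAvg_eq_straight_sub_grad, Lam_eq_zero_of_axialGauge hA, Lam_eq_zero_of_axialGauge hA, sub_zero, add_zero]

/-- [folklore] **RIGIDITY OF THE AXIAL GAUGE:** if `A` and `A − grad λ` are both axial, `λ` is constant on every block
(so the residual gauge freedom is `λ|_{coarse lattice}`, cf. «we restrict the gauge transformations by the condition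
λ(y) = 0, y ∈ T^{(1)}_L … and we remove [the rest] by introducing Axial (Ax) gauge fixing conditions», [B5] p.19). -/
theorem axialGauge_rigid {A : Form1 d R} {lam : Site d → R} {L : ℕ} (hA : AxialGauge A L)
    (hA' : AxialGauge (A - grad lam) L) (y : Site d) {b : Fin d → ℕ} (hb : b ∈ box d L) :
    lam ((L : ℤ) • y + toSite b) = lam ((L : ℤ) • y) := by
  have h := hA' y b hb
  rw [axial_sum_sub, axial_sum_grad, hA y b hb, zero_sub, neg_eq_zero, sub_eq_zero] at h
  exact h

/-- [folklore] The zero offset is the base point. -/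
@[simp] theorem toSite_zero : toSite (fun _ : Fin d => (0 : ℕ)) = (0 : Site d) := by
  funext i; simp [toSite]

/-- [folklore] Coarse block index of a fine point: `⌊x_i / L⌋` coordinatewise. -/
def blk (L : ℕ) (x : Site d) : Site d := fun i => x i / (L : ℤ)

/-- [folklore] Offset of a fine point in its block: `x_i mod L` coordinatewise. -/
def off (L : ℕ) (x : Site d) : Fin d → ℕ := fun i => (x i % (L : ℤ)).toNat

/-- [folklore] The offset lies in the box `{0,…,L−1}^d`. -/
theorem off_mem_box {L : ℕ} (hL : 1 ≤ L) (x : Site d) : off L x ∈ box d L := by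
  have hL0 : (0 : ℤ) < L := by exact_mod_cast hL
  simp only [AffineAveraging.box, Fintype.mem_piFinset, Finset.mem_range, off]
  intro i
  have h1 := Int.emod_nonneg (x i) hL0.ne'
  have h2 := Int.emod_lt_of_pos (x i) hL0
  omega

/-- [folklore] Block decomposition `x = L·blk x + off x`. -/
theorem blk_add_off {L : ℕ} (hL : 1 ≤ L) (x : Site d) : (L : ℤ) • blk L x + toSite (off L x) = x := by
  have hL0 : (0 : ℤ) < L := by exact_mod_cast hL
  funext i
  simp only [Pi.add_apply, Pi.smul_apply, blk, off, toSite, smul_eq_mul]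
  rw [Int.toNat_of_nonneg (Int.emod_nonneg _ hL0.ne')]
  exact Int.mul_ediv_add_emod (x i) L

/-- [folklore] The block index of `L·y + b`, `b ∈ {0,…,L−1}^d`, is `y`. -/
theorem blk_block {L : ℕ} (y : Site d) {b : Fin d → ℕ} (hb : b ∈ box d L) : blk L ((L : ℤ) • y + toSite b) = y := by
  have hb' : ∀ i, b i < L := by simpa [AffineAveraging.box, Fintype.mem_piFinset, Finset.mem_range] using hb
  funext i
  have hi := hb' i
  have hL0 : (L : ℤ) ≠ 0 := by omega
  simp only [blk, Pi.add_apply, Pi.smul_apply, toSite, smul_eq_mul]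
  rw [add_comm, Int.add_mul_ediv_left _ _ hL0, Int.ediv_eq_zero_of_lt (by positivity) (by exact_mod_cast hi),
    zero_add]

/-- [folklore] THE TREE GAUGE: `λ_A(x) = A(Γ_{y(x),x})`, the integral of `A` along the axial contour from the base
point of the block of `x`. -/
def treeGauge (A : Form1 d R) (L : ℕ) (x : Site d) : R := (axial A ((L : ℤ) • blk L x) x).sum

/-- [folklore] **THE AXIAL GAUGE IS ATTAINABLE:** `A − grad λ_A` satisfies (1.10) — every field is gauge equivalent to
an axial one (with `axialGauge_rigid`: uniquely up to block-constant `λ`). Needs `d ≥ 1` only through `b ∈ box`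
being inhabited-or-vacuous; no hypothesis on `L` beyond what `box d L` encodes. -/
theorem axialGauge_treeGauge (A : Form1 d R) (L : ℕ) : AxialGauge (A - grad (treeGauge A L)) L := by
  intro y b hb
  have hb' : ∀ i, b i < L := by simpa [AffineAveraging.box, Fintype.mem_piFinset, Finset.mem_range] using hb
  have hb0 : (fun _ => (0 : ℕ)) ∈ box d L := by
    simp only [AffineAveraging.box, Fintype.mem_piFinset, Finset.mem_range]
    intro i; have := hb' i; omega
  have h0 : blk L ((L : ℤ) • y) = y := by
    have h := blk_block (L := L) y hb0
    rwa [toSite_zero, add_zero] at h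
  rw [axial_sum_sub, axial_sum_grad, treeGauge, treeGauge, blk_block y hb, h0, axial_self, List.sum_nil, sub_zero,
    sub_self]

end Gauge

section GaugeBridge

variable {d : ℕ} {R : Type*} [CommRing R]

/-- [folklore] Over a commutative ring, `blockTotal lam L = AffineAveraging.blockSum L lam`. -/
theorem blockTotal_eq_blockSum (lam : Form0 d R) (L : ℕ) (y : Site d) : blockTotal lam L y = blockSum L lam y := rfl

/-- [folklore] (1.13) in an2's vocabulary: `contourSum L (A − dz λ) = contourSum L A − dz (blockSum L λ)`. -/
theorem contourSum_gauge (A : Form1 d R) (lam : Form0 d R) (L : ℕ) (μ : Fin d) (y : Site d) :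
    contourSum L (A - dz lam) μ y = contourSum L A μ y - dz (blockSum L lam) μ y := by
  rw [← straightSum_eq_contourSum, ← straightSum_eq_contourSum, ← grad_eq_dz, straightSum_gauge]
  rfl

/-- [folklore] (1.8) = (1.11) on axial-gauge fields, in an2's vocabulary. -/
theorem linAvg_eq_contourSum_of_axialGauge {A : Form1 d R} {L : ℕ} (hA : AxialGauge A L) (μ : Fin d) (y : Site d) :
    linAvg A L μ y = contourSum L A μ y := by
  rw [linAvg_eq_straightSum_of_axialGauge hA, straightSum_eq_contourSum]

end GaugeBridge

/-! ## §6 Kernel example (`decide`): the six letters of `Γ_{c,x}` on `ℤ²`, `L = 2` -/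

section Example

/-- [folklore] Labelling one-form on `ℤ²`: the bond `⟨x, x + e_κ⟩` carries `100κ + 10x₀ + x₁`. -/
def label : Form1 2 ℤ := fun κ x => 100 * (κ : ℤ) + 10 * x 0 + x 1

/-- [folklore] For `c = ⟨(0,0), (2,0)⟩` (`L = 2`, `μ = 0`, `y = 0`) and `x = (1,1)` (`b = (1,1)`):
`Γ_{c,x} = ⟨(0,0),(0,1)⟩ ⟨(0,1),(1,1)⟩ · ⟨(1,1),(2,1)⟩ ⟨(2,1),(3,1)⟩ · ⟨(3,1),(2,1)⟩ ⟨(2,1),(2,0)⟩`, letters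
`[A₁(0,0), A₀(0,1), A₀(1,1), A₀(2,1), −A₀(2,1), −A₁(2,0)] = [100, 1, 11, 21, −21, −120]` (the printed order: `x₂`
moved first; the return path backtracks over `⟨(2,1),(3,1)⟩`). -/
theorem example_gammaC : gammaC label 2 0 (fun _ => 0) (fun _ => 1) = [100, 1, 11, 21, -21, -120] := by
  decide

/-- [folklore] … and the closed loop `Γ_{c,x} ∪ (−c)` appends `[−A₀(1,0), −A₀(0,0)] = [−10, 0]`. -/
theorem example_loopC : loopC label 2 0 (fun _ => 0) (fun _ => 1) = [100, 1, 11, 21, -21, -120, -10, 0] := by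
  decide

end Example

end Literature.MathematicalPhysics.QuantumFieldTheory.Balaban1983to89.Beta.AveragingContours
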